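import Summits.RiemannHypothesis.RiemannHypothesis.Theorems.WeilFormatCDataLog4HalfTables
import HarnessLib

/-!
# rh-explicit (venture WeilGRH): validity of the `(log 4)/2` rung's special-value table below mode 17 — input of the Christoffel
  certificates at `a = (log 4)/2` (prime powers 2, 3) (weil-3 gen16)

Cell `rh-explicit`, WEIL TRACK (structure seat weil-3, gen16).  Kernel certificates only, as ONE Boolean conjunction
(`checks_below_seventeen`) and ONE propositional conjunction (`inputs_valid`: `0 < a ∧ PrimeData a ks ∧ ConstsValid (2^80) a ks C ∧
TabValid (2^80) a ks 17 tab`) — no declaration repeats, even up to renaming, a statement of the format-C lane's validity files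
(`WeilFormatCDataLog4HalfTabValidA`, rh-explicit-weil-grh-2, accepted but unbuilt at the time of writing; `…Log3HalfTabValid`).  Inputs:
`π ∈ P`, `a ∈ A`, the constants record, the prime data `{2, 3}` and the table slices `[0, 9)`, `[9, 17)` of
`WeilFormatCDataLog4HalfTables.tab` (BUILT).  Consumed by the 33-mode certificates `RigidityCertsLog4HalfP*`.
RH-free; no definitions; standard axioms; nothing here bears on the truth of RH.
-/

set_option linter.dupNamespace false
set_option maxRecDepth 200000
set_option autoImplicit false

namespace Summit.Ventures.WeilGRH.Christoffel.Log4Half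

open Literature.NumberTheory.LFunctions Literature.NumberTheory.LFunctions.Yoshida1992 Encl
  Literature.Analysis.ValidatedNumerics.NumericsMP
open Summit.RiemannHypothesis.RiemannHypothesis.Theorems.WeilFormatCData.Log4Half

/-- kernel: `π ∈ P`, `a ∈ A`, the constants record, the prime data, and the table slices `[0, 9)`, `[9, 17)` — one conjunction. -/
theorem checks_below_seventeen :
    (checkPi (2 ^ 80) 70 P && checkHalfLogNat (2 ^ 80) 96 4 A && checkConsts prm P A ks C &&
      checkPrimeDataHalfLog 4 ks && checkTable prm C tab 0 9 && checkTable prm C tab 9 8) = true := by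
  decide +kernel

/-- **The inputs of the `(log 4)/2` certificates are valid**: `0 < a`, the prime data `{2,3}` is the window's, the constants record is
valid, and the special-value table is valid below mode `17`. -/
theorem inputs_valid :
    (0 : ℝ) < a ∧ PrimeData a ks ∧ ConstsValid (2 ^ 80) a ks C ∧ TabValid (2 ^ 80) a ks 17 tab := by
  have h := checks_below_seventeen
  simp only [Bool.and_eq_true] at h
  obtain ⟨⟨⟨⟨⟨hP, hA⟩, hC⟩, hK⟩, hT0⟩, hT9⟩ := h
  have ha0 : (0 : ℝ) < a := by
    unfold a
    have : (1 : ℝ) < 4 := by norm_num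
    positivity
  have hpi : MI.mem (2 ^ 80) Real.pi P := mem_pi_of_checkPi (by norm_num) hP
  have ha : MI.mem (2 ^ 80) a A := by
    unfold a
    exact mem_of_checkHalfLogNat (S := 2 ^ 80) (by norm_num) hA
  have hc : ConstsValid (2 ^ 80) a ks C :=
    constsValid_of_checkConsts (prm := prm) (by norm_num [prm]) (by norm_num [prm]) hpi ha hC
  have hk : PrimeData a ks := by
    have h := primeData_of_checkHalfLog hK
    unfold a; exact_mod_cast h
  have h9 : TabValid (2 ^ 80) a ks (0 + 9) tab :=
    (TabValid.zero (S := 2 ^ 80) (a := a) (ks := ks) (tab := tab)).extend fun n hn hnk ↦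
      idxValid_of_checkTable (prm := prm) (by norm_num [prm]) ha0 hc hT0 hn hnk
  exact ⟨ha0, hk, hc, h9.extend fun n hn hnk ↦ idxValid_of_checkTable (prm := prm) (by norm_num [prm]) ha0 hc hT9 hn hnk⟩

end Summit.Ventures.WeilGRH.Christoffel.Log4Half
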